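import Literature.NumberTheory.EllipticCurves.SelmerGaloisActionPlaces
import Summits.BirchSwinnertonDyer.BirchSwinnertonDyer.Theorems.Rank1ResidualJetPairingCountingPermutation
import HarnessLib

/-!
# T1 JET (cell `bsd-jet`), road K, stub S1 (Galois half): `σ_*`-stability of Selmer groups of
# `σ`-stable Selmer structures on `E[n]`, and the X-side transport data of the `±` counting from
# `conjActPlace`

HONEST FRAMING (programme file `BSD-LIT2PART-PROGRAMME-v1.md` §HONESTY, verbatim): «no tranche here
proves BSD; ARM L moves the LITERAL column of an r ≤ 1 census into the kernel-proved-modulo-named-print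
column; ARM P changes what «named print» is worth.» THEOREMS ONLY (seat `bsd-jet-pv-1`, session g4;
`--supports stmt-BirchSwinnertonDyer-14418`, helper): no definition, no named fact, no `sorry`.
Nothing is booked; 0 classes move.

## Why (sheets `HOME/sheets/PV2-J6-KERNEL.ADDENDUM-1.md` §2, `PV1-ROADK-PTCOUNT.md` §2 (a))

The sign-by-sign Poitou–Tate counting for product groups
(`Rank1ResidualJetPairingCountingPermutation.lean`, p486423) reduces every `τ`-hypothesis to PER-PLACE
data: transports `eX i j : X_i → X_j` along a place involution `π`, round trips, equivariance of
`loc_T`, stability of the global subgroup `S`. For `X_v = H¹(K_v, E[p^m])` these data now exist in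
the tree: `conjActPlace W σ n (h : σ • v = w)` (`Literature/…/SelmerGaloisActionPlaces.lean`,
p489813) with `conjActPlace_localization`, `conjActPlace_conjActPlace` (`σ² = 1`),
`conjActPlace_mem_kummerSelmerStructure`. This file assembles them:

* `conjAct_mem_selmerGroup_of_transport` — **the Selmer group of a `σ`-stable Selmer structure `𝓖`
  on `E[n]` is `conjAct`-stable** (`σ_*` carries `𝓖_v` into `𝓖_{σv}` at the finite places; the
  infinite conditions are everything, as at complex places): the hypothesis `hS` of
  `piTransport_mem_map` ∕ `map_inf_ker_sub/add_id_eq` for `S = H¹_𝓖(K, E[p^m])`, i.e. the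
  `Gal(K/ℚ)`-module structure on Jetchev's `𝓗_{𝓕(c)}`, `𝓗_{𝓕_⌈q⌉(c)}`, … (§6.2) presupposed by
  their `±`-parts `𝓗^±`;
* `exists_piTransport_conjActPlace` — for `σ² = 1` and a `σ`-stable finite set `T` of finite places:
  the place involution `π = (σ • ·)`, the transports `eX` (= `conjActPlace` on pairs `σ • i = j`)
  and the endomorphism `τ_X` of `Π_{v∈T} H¹(K_v, E[n])`, WITH round trip, identification and
  `loc_T`-equivariance for `c = conjAct W σ n` — every X-side input of
  `relIndex_mul_relIndex_eq_of_iInf_ker_sup_plus/minus_of_piTransport`.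

What is NOT here (remaining Galois input of S1): the dual side `τ_Y` on `Π H¹(K_v, E[n]^D)` and the
adjointness `inv_{σv}(σ_* x ∪ σ_* y) = inv_v(x ∪ y)` of the local Tate pairings (a property of the
invariant maps; the tree's `LocalInvariants` family is abstract).

References (locators only; no cited FACT is declared): [cite: Jetchev2008, §5 Thm. 5.1 (p. 822), §6.2
(p. 823)] [cite: GrossLMS1991, §5 (5.1), Prop. 8.2] [cite: CasselsFrohlichANT1967, Ch. VII §1.1].
Design: no definitions; universe `u` for `K`. Axioms: `propext`, `Classical.choice`, `Quot.sound`.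
-/

set_option autoImplicit false

noncomputable section

open scoped Classical
open WeierstrassCurve

universe u



namespace Summit.BirchSwinnertonDyer.Rank1Residual.JET.GlobalDuality

section ConjActSelmer

open NumberField IsDedekindDomain
open Literature.NumberTheory.EllipticCurves Literature.NumberTheory.GaloisRepresentations
open Literature.NumberTheory.GaloisRepresentations.DiscreteGaloisModule (SelmerStructure)

variable {K : Type u} [Field K] [NumberField K] (W : WeierstrassCurve ℚ) (σ : K ≃ₐ[ℚ] K) (n : ℤ)

/-- **The Selmer group of a `σ`-stable Selmer structure on `E[n]` is `σ_*`-stable.** If `σ_*`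
(`conjActPlace`) carries the local condition `𝓖_v` into `𝓖_{σ v}` at every finite place and the
conditions at the infinite places are everything (the case of a totally complex `K`, where
`H¹(K_w, ·) = 0` anyway), then `σ_* = conjAct W σ n` maps `H¹_𝓖(K, E[n])` into itself
(`loc_{σv} ∘ σ_* = σ_* ∘ loc_v`, `conjActPlace_localization`). Generalises the tree's
`conjAct_mem_selmerGroup` (Kummer structure) to arbitrary structures — Jetchev's `𝓕(c)`,
`𝓕_⌈q⌉(c)`, `(𝓕₀)^ℓ(c)`, whose Selmer modules `𝓗^{±}` (§6.2) presuppose this stability.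
[cite: Jetchev2008, §4.3 and §6.2 (p. 823)] [cite: GrossLMS1991, §5 (5.1)] -/
theorem conjAct_mem_selmerGroup_of_transport
    (𝓖 : SelmerStructure ((W.baseChange K).torsionGaloisModule n))
    (hfin : ∀ (v w : HeightOneSpectrum (𝓞 K)) (h : σ • v = w)
      (c : galoisCohomology (((W.baseChange K).torsionGaloisModule n).toLocal
        (Sum.inr v : Place K)) 1), c ∈ 𝓖 (Sum.inr v) → conjActPlace W σ n h c ∈ 𝓖 (Sum.inr w))
    (hinf : ∀ w : InfinitePlace K, 𝓖 (Sum.inl w) = ⊤)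
    {s : galH1Torsion (W.baseChange K) n} (hs : s ∈ 𝓖.selmerGroup) :
    conjAct W σ n s ∈ 𝓖.selmerGroup := by
  have hs' := (SelmerStructure.mem_selmerGroup_iff 𝓖 s).mp hs
  refine (SelmerStructure.mem_selmerGroup_iff 𝓖 (conjAct W σ n s)).mpr ?_
  rintro (w | w')
  · rw [hinf]; trivial
  · have h : σ • (σ⁻¹ • w') = w' := smul_inv_smul σ w'
    rw [← conjActPlace_localization W σ n h s]
    exact hfin _ _ h _ (hs' _)

/-- **The X-side transport data of the `±` counting, at the finite places, from `conjActPlace`.**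
For `σ² = 1` and a `σ`-stable finite set `T` of finite places: the place involution
`π = (σ • ·)` on `T`, the transports `eX i j = σ_* : H¹(K_i, E[n]) → H¹(K_j, E[n])` when `σ • i = j`
(else `0`) and the induced endomorphism `τ_X` of `Π_{v∈T} H¹(K_v, E[n])`, WITH the three per-place
properties consumed by `Rank1ResidualJetPairingCountingPermutation` (`piTransport_involutive`,
`piTransport_mem_map`, `map_inf_ker_sub/add_id_eq`, `…_of_piTransport`): round trip
(`conjActPlace_conjActPlace`), identification with `conjActPlace`, and equivariance of the
localisation tuple `loc_T` for `c = conjAct W σ n` (`conjActPlace_localization`). What is NOT here: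
the dual side `τ_Y` on `Π H¹(K_v, E[n]^D)` and the adjointness of the local Tate pairings.
[cite: Jetchev2008, §5 Thm. 5.1 (p. 822)] [cite: CasselsFrohlichANT1967, Ch. VII §1.1] -/
theorem exists_piTransport_conjActPlace (hσ : σ * σ = 1) (T : Finset (HeightOneSpectrum (𝓞 K)))
    (hT : ∀ t ∈ T, σ • t ∈ T) :
    ∃ (π : T → T)
      (eX : ∀ i j : T,
        galoisCohomology (((W.baseChange K).torsionGaloisModule n).toLocal
          (Sum.inr (i : HeightOneSpectrum (𝓞 K)) : Place K)) 1 →+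
        galoisCohomology (((W.baseChange K).torsionGaloisModule n).toLocal
          (Sum.inr (j : HeightOneSpectrum (𝓞 K)) : Place K)) 1)
      (τX : (∀ i : T, galoisCohomology (((W.baseChange K).torsionGaloisModule n).toLocal
          (Sum.inr (i : HeightOneSpectrum (𝓞 K)) : Place K)) 1) →+
        ∀ i : T, galoisCohomology (((W.baseChange K).torsionGaloisModule n).toLocal
          (Sum.inr (i : HeightOneSpectrum (𝓞 K)) : Place K)) 1),
      Function.Involutive π ∧
      (∀ i : T, ((π i : T) : HeightOneSpectrum (𝓞 K)) = σ • (i : HeightOneSpectrum (𝓞 K))) ∧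
      (∀ (i j : T) (h : σ • (i : HeightOneSpectrum (𝓞 K)) = j), eX i j = conjActPlace W σ n h) ∧
      (∀ x j, τX x j = eX (π j) j (x (π j))) ∧
      (∀ j y, eX (π j) j (eX j (π j) y) = y) ∧
      (∀ (j : T) (s : galH1Torsion (W.baseChange K) n),
        galoisCohomology.localization ((W.baseChange K).torsionGaloisModule n)
            (Sum.inr (j : HeightOneSpectrum (𝓞 K)) : Place K) 1 (conjAct W σ n s) =
          eX (π j) j (galoisCohomology.localization ((W.baseChange K).torsionGaloisModule n)
            (Sum.inr ((π j : T) : HeightOneSpectrum (𝓞 K)) : Place K) 1 s)) := by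
  have hσσ : ∀ v : HeightOneSpectrum (𝓞 K), σ • σ • v = v := fun v => by
    rw [← mul_smul, hσ, one_smul]
  let π : T → T := fun t => ⟨σ • (t : HeightOneSpectrum (𝓞 K)), hT _ t.2⟩
  have hπ : ∀ i : T, ((π i : T) : HeightOneSpectrum (𝓞 K)) = σ • (i : HeightOneSpectrum (𝓞 K)) :=
    fun _ => rfl
  let eX : ∀ i j : T,
      galoisCohomology (((W.baseChange K).torsionGaloisModule n).toLocal
        (Sum.inr (i : HeightOneSpectrum (𝓞 K)) : Place K)) 1 →+
      galoisCohomology (((W.baseChange K).torsionGaloisModule n).toLocal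
        (Sum.inr (j : HeightOneSpectrum (𝓞 K)) : Place K)) 1 :=
    fun i j => if h : σ • (i : HeightOneSpectrum (𝓞 K)) = j then conjActPlace W σ n h else 0
  have heX : ∀ (i j : T) (h : σ • (i : HeightOneSpectrum (𝓞 K)) = j),
      eX i j = conjActPlace W σ n h := fun i j h => dif_pos h
  obtain ⟨τX, hτX⟩ := piTransport_exists π eX
  refine ⟨π, eX, τX, fun i => Subtype.ext (hσσ i), hπ, heX, hτX, fun j y => ?_, fun j s => ?_⟩
  · rw [heX j (π j) rfl, heX (π j) j (hσσ j)]
    exact conjActPlace_conjActPlace W σ n hσ rfl (hσσ j) y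
  · rw [heX (π j) j (hσσ j)]
    exact (conjActPlace_localization W σ n (hσσ j) s).symm

end ConjActSelmer

end Summit.BirchSwinnertonDyer.Rank1Residual.JET.GlobalDuality

end
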